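import Summits.Ventures.Crystal3D.Theorems.StickyWulffConstantCoaxialWallLawGrainLedgerRimLocalTop
import Summits.Ventures.Crystal3D.Theorems.StickyWulffConstantCoaxialWallLawRigidLedger
import Summits.Ventures.Crystal3D.Theorems.StickyWulffConstantCoaxialWallLawTwinAbsorptionMoved
import Summits.Ventures.Crystal3D.Theorems.StickyWulffConstantCoaxialWallLawHaggConst
import Summits.Ventures.Crystal3D.Theorems.StickyWulffConstantGenericWallFloorCoaxialIff
import Summits.Ventures.Crystal3D.Theorems.StickyWulffConstantNoReconstructionGainLatticeAdhesion
import HarnessLib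

/-!
# The rigid twin rung of `stub_coaxialTwoSlabAdhesion`, RIM-LOCAL form (error `C·ρ + 15·#rim balls`)

HONEST FRAMING. Part of the venture `Summits/Ventures/Crystal3D` (cell `crystal3d-full`), helper
`--supports` the crux `CoaxialWallLaw` (stmt-Ventures-19481, `route-Ventures-StickyWulffConstant`),
REGISTERED line `WallLedgerF` (planner cf-p1 gen 16), stub `stub_coaxialTwoSlabAdhesion`.
RUNG CREDIT ONLY.  Answers the planner's SHAPE-3 question (ROUTE.md §73.10) for the F-line rigid
rung: the wall-law error is RIM-LOCAL — `C(A₁,t₁,A₂,t₂)·ρ` plus `15/2` per ball of `X` within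
lateral distance `2` of the cylinder's mantle — with NO dependence on the plate gap `h`.

* `coaxial_rigid_cell_ledger_rimLocal` — the two rim-local grain lemmas
  (`coaxial_grain_ledger_rimLocal`, `…_top`) summed over the partition `X = (X ∩ Λ₁) ⊔ (X ∩ Λ₂)`:
  `2·D(X) + 15·#{rim balls of X} ≥ Σᵢ (2φᵢ + (√6/4)·√(1 − ⟪Mᵢe₃, e₃⟫²)) πρ² − 255√2 π ρ`
  (pair-agnostic: absorption as hypothesis).
* `coaxial_twin_frames` — frame normalisation of a co-axial TWIN pair (`σ 0 ≠ σ' 0`) together with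
  the discharge of the absorption hypothesis on a rigid filling (`twin_absorption_inPlane_moved/'`).
* `coaxialTwoSlabAdhesion_rigid_twin_rimLocal` — for a co-axial pair with different linear parts and
  no coincidence sites, and every RIGID filling of the clamped cylinder cell (any `h ≥ 0`, `ρ ≥ 3`):

  `cross(P₁, X∖P₁) + cross(P₂, Y) ≤ D(Y) + (φ₁ + φ₂ − (√6/4)·√(1 − ⟪L e₃, e₃⟫²)) πρ² + C ρ + (15/2)·#{x ∈ X : (ρ−2)² < x₀² + x₁²}`.

WHAT THIS IS NOT: the stub (arbitrary fillings, translation pairs, CSL twins not covered here);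
rung F-C1 not moved.
-/

noncomputable section

namespace Summit.Ventures.Crystal3D.Theorems

open Summit.Ventures.Crystal3D Finset
open Literature.MathematicalPhysics.StatisticalMechanics (fccStacking barlowStacking IsHaggSeq
  contactDeficiency)
open scoped InnerProductSpace

open scoped Classical in
/-- **The rim-local two-grain ledger of a rigid co-axial wall cell.**  See the module docstring. -/
theorem coaxial_rigid_cell_ledger_rimLocal
    (M₁ : EuclideanSpace ℝ (Fin 3) ≃ₗᵢ[ℝ] EuclideanSpace ℝ (Fin 3)) (t₁ : EuclideanSpace ℝ (Fin 3))
    (M₂ : EuclideanSpace ℝ (Fin 3) ≃ₗᵢ[ℝ] EuclideanSpace ℝ (Fin 3)) (t₂ : EuclideanSpace ℝ (Fin 3))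
    (X P₁ P₂ : Finset (EuclideanSpace ℝ (Fin 3))) (R₀ h ρ : ℝ) (hR₀ : 3 ≤ R₀) (hρ : R₀ ≤ ρ)
    (hX : ∀ p ∈ X, ∀ q ∈ X, p ≠ q → 1 ≤ dist p q)
    (hcell : ∀ p ∈ X, -(2 * R₀) ≤ p 2 ∧ p 2 ≤ h + 2 * R₀ ∧ p 0 ^ 2 + p 1 ^ 2 ≤ ρ ^ 2)
    (hP₁X : P₁ ⊆ X) (hP₂X : P₂ ⊆ X)
    (hP₁ : ∀ p, p ∈ P₁ ↔ (p ∈ (fun q => M₁ q + t₁) '' fccStacking 1 (Real.sqrt (2 / 3)) ∧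
      -(2 * R₀) ≤ p 2 ∧ p 2 ≤ -R₀ ∧ p 0 ^ 2 + p 1 ^ 2 ≤ ρ ^ 2))
    (hP₂ : ∀ p, p ∈ P₂ ↔ (p ∈ (fun q => M₂ q + t₂) '' fccStacking 1 (Real.sqrt (2 / 3)) ∧
      h + R₀ ≤ p 2 ∧ p 2 ≤ h + 2 * R₀ ∧ p 0 ^ 2 + p 1 ^ 2 ≤ ρ ^ 2))
    (hdisj : ∀ p ∈ (fun q => M₁ q + t₁) '' fccStacking 1 (Real.sqrt (2 / 3)),
      p ∉ (fun q => M₂ q + t₂) '' fccStacking 1 (Real.sqrt (2 / 3)))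
    (hrigid : ∀ p ∈ X, p ∈ (fun q => M₁ q + t₁) '' fccStacking 1 (Real.sqrt (2 / 3)) ∨
      p ∈ (fun q => M₂ q + t₂) '' fccStacking 1 (Real.sqrt (2 / 3)))
    (habs₁ : ∀ x ∈ X, x ∈ (fun q => M₁ q + t₁) '' fccStacking 1 (Real.sqrt (2 / 3)) →
      (fccSlots.filter fun w => w 2 = 0 ∧ x + M₁ w ∉ X).card +
        4 * (X.filter fun q => dist x q = 1).card ≤ 48)
    (habs₂ : ∀ x ∈ X, x ∈ (fun q => M₂ q + t₂) '' fccStacking 1 (Real.sqrt (2 / 3)) →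
      (fccSlots.filter fun w => w 2 = 0 ∧ x + M₂ w ∉ X).card +
        4 * (X.filter fun q => dist x q = 1).card ≤ 48) :
    (2 * (Real.sqrt 2 / 4 * ∑ w ∈ fccSlots, |⟪M₁ w, EuclideanSpace.single (2 : Fin 3) (1 : ℝ)⟫_ℝ|) +
        Real.sqrt 6 / 4 * Real.sqrt (1 - ⟪M₁ (EuclideanSpace.single (2 : Fin 3) (1 : ℝ)),
          EuclideanSpace.single (2 : Fin 3) (1 : ℝ)⟫_ℝ ^ 2)) * Real.pi * ρ ^ 2 +
      (2 * (Real.sqrt 2 / 4 * ∑ w ∈ fccSlots, |⟪M₂ w, EuclideanSpace.single (2 : Fin 3) (1 : ℝ)⟫_ℝ|) +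
        Real.sqrt 6 / 4 * Real.sqrt (1 - ⟪M₂ (EuclideanSpace.single (2 : Fin 3) (1 : ℝ)),
          EuclideanSpace.single (2 : Fin 3) (1 : ℝ)⟫_ℝ ^ 2)) * Real.pi * ρ ^ 2 -
      255 * Real.sqrt 2 * Real.pi * ρ ≤
      2 * contactDeficiency X + 15 * ((X.filter fun x => (ρ - 2) ^ 2 < x 0 ^ 2 + x 1 ^ 2).card : ℝ) := by
  classical
  set Λ₁ : Set (EuclideanSpace ℝ (Fin 3)) := (fun q => M₁ q + t₁) '' fccStacking 1 (Real.sqrt (2 / 3)) with hΛ₁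
  set Λ₂ : Set (EuclideanSpace ℝ (Fin 3)) := (fun q => M₂ q + t₂) '' fccStacking 1 (Real.sqrt (2 / 3)) with hΛ₂
  have g₁ := coaxial_grain_ledger_rimLocal M₁ t₁ X P₁ R₀ h ρ hR₀ hρ hX hcell hP₁X hP₁ habs₁
  have g₂ := coaxial_grain_ledger_rimLocal_top M₂ t₂ X P₂ R₀ h ρ hR₀ hρ hX hcell hP₂X hP₂ habs₂
  -- the two grains partition `X`
  have hunion : (X.filter fun p => p ∈ Λ₁) ∪ (X.filter fun p => p ∈ Λ₂) = X := by
    ext p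
    simp only [mem_union, mem_filter]
    constructor
    · rintro (⟨hp, -⟩ | ⟨hp, -⟩) <;> exact hp
    · intro hp
      rcases hrigid p hp with h1 | h2
      · exact Or.inl ⟨hp, h1⟩
      · exact Or.inr ⟨hp, h2⟩
  have hdj : Disjoint (X.filter fun p => p ∈ Λ₁) (X.filter fun p => p ∈ Λ₂) := by
    rw [disjoint_filter]
    exact fun p _ h1 h2 => hdisj p h1 h2
  have hsplit : ∑ x ∈ X, ((12 : ℝ) - ((X.filter fun q => dist x q = 1).card : ℝ)) =
      ∑ x ∈ X.filter (fun p => p ∈ Λ₁), ((12 : ℝ) - ((X.filter fun q => dist x q = 1).card : ℝ)) +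
        ∑ x ∈ X.filter (fun p => p ∈ Λ₂), ((12 : ℝ) - ((X.filter fun q => dist x q = 1).card : ℝ)) := by
    rw [← sum_union hdj, hunion]
  have hrim : (((X.filter fun p => p ∈ Λ₁).filter fun x => (ρ - 2) ^ 2 < x 0 ^ 2 + x 1 ^ 2).card : ℝ) +
      (((X.filter fun p => p ∈ Λ₂).filter fun x => (ρ - 2) ^ 2 < x 0 ^ 2 + x 1 ^ 2).card : ℝ) =
      ((X.filter fun x => (ρ - 2) ^ 2 < x 0 ^ 2 + x 1 ^ 2).card : ℝ) := by
    have hdj' : Disjoint ((X.filter fun p => p ∈ Λ₁).filter fun x => (ρ - 2) ^ 2 < x 0 ^ 2 + x 1 ^ 2)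
        ((X.filter fun p => p ∈ Λ₂).filter fun x => (ρ - 2) ^ 2 < x 0 ^ 2 + x 1 ^ 2) :=
      disjoint_filter_filter hdj
    have h := card_union_of_disjoint hdj'
    rw [← filter_union, hunion] at h
    exact_mod_cast h.symm
  rw [two_mul_contactDeficiency_eq_sum, hsplit, ← hrim]
  linarith

/-- **Frame normalisation of a co-axial TWIN pair on a rigid filling.**  If `Aᵢ·Λ₀ + tᵢ ⊆ L·B(σᵢ) + sᵢ`
with `σ 0 ≠ σ' 0`, the grains are disjoint and `X ⊆ Λ₁ ∪ Λ₂` is `1`-separated, then there are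
isometries `M₁, M₂ ∈ {L, R∘L}` (`R` the half-turn about `e₃`) presenting the grains as
`Mᵢ·Λ₀ + sᵢ`, with `Mᵢ e₃ = L e₃`, such that every grain ball of `X` satisfies the crude absorption
inequality about its grain's basal plane. -/
theorem coaxial_twin_frames
    (A₁ : EuclideanSpace ℝ (Fin 3) ≃ₗᵢ[ℝ] EuclideanSpace ℝ (Fin 3)) (t₁ : EuclideanSpace ℝ (Fin 3))
    (A₂ : EuclideanSpace ℝ (Fin 3) ≃ₗᵢ[ℝ] EuclideanSpace ℝ (Fin 3)) (t₂ : EuclideanSpace ℝ (Fin 3))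
    (L : EuclideanSpace ℝ (Fin 3) ≃ₗᵢ[ℝ] EuclideanSpace ℝ (Fin 3)) (s₁ s₂ : EuclideanSpace ℝ (Fin 3))
    {σ σ' : ℤ → ℤ} (hσ : IsHaggSeq σ) (hσ' : IsHaggSeq σ') (htw : σ 0 ≠ σ' 0)
    (hsub₁ : (fun q => A₁ q + t₁) '' fccStacking 1 (Real.sqrt (2 / 3)) ⊆
      (fun p => L p + s₁) '' barlowStacking 1 (Real.sqrt (2 / 3)) σ)
    (hsub₂ : (fun q => A₂ q + t₂) '' fccStacking 1 (Real.sqrt (2 / 3)) ⊆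
      (fun p => L p + s₂) '' barlowStacking 1 (Real.sqrt (2 / 3)) σ')
    (hdisj : ∀ p ∈ (fun q => A₁ q + t₁) '' fccStacking 1 (Real.sqrt (2 / 3)),
      p ∉ (fun q => A₂ q + t₂) '' fccStacking 1 (Real.sqrt (2 / 3)))
    (X : Finset (EuclideanSpace ℝ (Fin 3)))
    (hX : ∀ p ∈ X, ∀ q ∈ X, p ≠ q → 1 ≤ dist p q)
    (hrigid : ∀ p ∈ X, p ∈ (fun q => A₁ q + t₁) '' fccStacking 1 (Real.sqrt (2 / 3)) ∨
      p ∈ (fun q => A₂ q + t₂) '' fccStacking 1 (Real.sqrt (2 / 3))) :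
    ∃ M₁ M₂ : EuclideanSpace ℝ (Fin 3) ≃ₗᵢ[ℝ] EuclideanSpace ℝ (Fin 3),
      (fun q => A₁ q + t₁) '' fccStacking 1 (Real.sqrt (2 / 3)) =
        (fun q => M₁ q + s₁) '' fccStacking 1 (Real.sqrt (2 / 3)) ∧
      (fun q => A₂ q + t₂) '' fccStacking 1 (Real.sqrt (2 / 3)) =
        (fun q => M₂ q + s₂) '' fccStacking 1 (Real.sqrt (2 / 3)) ∧
      M₁ (EuclideanSpace.single (2 : Fin 3) (1 : ℝ)) = L (EuclideanSpace.single (2 : Fin 3) (1 : ℝ)) ∧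
      M₂ (EuclideanSpace.single (2 : Fin 3) (1 : ℝ)) = L (EuclideanSpace.single (2 : Fin 3) (1 : ℝ)) ∧
      (∀ x ∈ X, x ∈ (fun q => M₁ q + s₁) '' fccStacking 1 (Real.sqrt (2 / 3)) →
        (fccSlots.filter fun w => w 2 = 0 ∧ x + M₁ w ∉ X).card +
          4 * (X.filter fun q => dist x q = 1).card ≤ 48) ∧
      (∀ x ∈ X, x ∈ (fun q => M₂ q + s₂) '' fccStacking 1 (Real.sqrt (2 / 3)) →
        (fccSlots.filter fun w => w 2 = 0 ∧ x + M₂ w ∉ X).card +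
          4 * (X.filter fun q => dist x q = 1).card ≤ 48) := by
  classical
  set R : EuclideanSpace ℝ (Fin 3) ≃ₗᵢ[ℝ] EuclideanSpace ℝ (Fin 3) :=
    (ℝ ∙ EuclideanSpace.single (2 : Fin 3) (1 : ℝ)).reflection with hR
  rcases hσ 0 with h1 | hm1
  · -- grain 1 in the fcc word, grain 2 in the twin word
    have hm1' : σ' 0 = -1 := (hσ' 0).resolve_left fun h' => htw (h1.trans h'.symm)
    have e₁ := coaxial_frame_eq_fcc_of_one A₁ t₁ L s₁ hσ hsub₁ h1
    obtain ⟨e₂, ax₂⟩ := coaxial_frame_eq_fcc_of_neg_one A₂ t₂ L s₂ hσ' hsub₂ hm1'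
    have hrigid' := hrigid
    have hdisj' := hdisj
    simp only [e₁, e₂] at hrigid' hdisj'
    refine ⟨L, R.trans L, e₁, e₂, rfl, ax₂, ?_, ?_⟩
    · intro x _ hxΛ
      exact twin_absorption_inPlane_moved L s₁ s₂ X hX hrigid' x hxΛ (hdisj' x hxΛ)
    · intro x _ hxΛ
      have hx' : x ∉ (fun q => L q + s₁) '' fccStacking 1 (Real.sqrt (2 / 3)) :=
        fun h' => hdisj' x h' hxΛ
      have key := twin_absorption_inPlane_moved' L s₁ s₂ X hX hrigid' x hxΛ hx'
      simpa only [LinearIsometryEquiv.trans_apply] using key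
  · -- grain 1 in the twin word, grain 2 in the fcc word
    have h1' : σ' 0 = 1 := (hσ' 0).resolve_right fun h' => htw (hm1.trans h'.symm)
    obtain ⟨e₁, ax₁⟩ := coaxial_frame_eq_fcc_of_neg_one A₁ t₁ L s₁ hσ hsub₁ hm1
    have e₂ := coaxial_frame_eq_fcc_of_one A₂ t₂ L s₂ hσ' hsub₂ h1'
    have hrigid' : ∀ p ∈ X, p ∈ (fun q => L q + s₂) '' fccStacking 1 (Real.sqrt (2 / 3)) ∨
        p ∈ (fun q => (R.trans L) q + s₁) '' fccStacking 1 (Real.sqrt (2 / 3)) := by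
      intro p hp
      have := hrigid p hp
      rw [e₁, e₂] at this
      exact this.symm
    have hdisj' : ∀ p ∈ (fun q => L q + s₂) '' fccStacking 1 (Real.sqrt (2 / 3)),
        p ∉ (fun q => (R.trans L) q + s₁) '' fccStacking 1 (Real.sqrt (2 / 3)) := by
      intro p hp2 hp1
      have := hdisj p
      rw [e₁, e₂] at this
      exact this hp1 hp2
    refine ⟨R.trans L, L, e₁, e₂, ax₁, rfl, ?_, ?_⟩
    · intro x _ hxΛ
      have hx' : x ∉ (fun q => L q + s₂) '' fccStacking 1 (Real.sqrt (2 / 3)) :=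
        fun h' => hdisj' x h' hxΛ
      have key := twin_absorption_inPlane_moved' L s₂ s₁ X hX hrigid' x hxΛ hx'
      simpa only [LinearIsometryEquiv.trans_apply] using key
    · intro x _ hxΛ
      exact twin_absorption_inPlane_moved L s₂ s₁ X hX hrigid' x hxΛ (hdisj' x hxΛ)

/-- **The rigid rung of `stub_coaxialTwoSlabAdhesion` for twin pairs without coincidence sites,
rim-local form** (`h`-free error, constant `√6/4`).  See the module docstring. -/
theorem coaxialTwoSlabAdhesion_rigid_twin_rimLocal
    (A₁ : EuclideanSpace ℝ (Fin 3) ≃ₗᵢ[ℝ] EuclideanSpace ℝ (Fin 3)) (t₁ : EuclideanSpace ℝ (Fin 3))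
    (A₂ : EuclideanSpace ℝ (Fin 3) ≃ₗᵢ[ℝ] EuclideanSpace ℝ (Fin 3)) (t₂ : EuclideanSpace ℝ (Fin 3))
    (hcoax : ∃ (L : EuclideanSpace ℝ (Fin 3) ≃ₗᵢ[ℝ] EuclideanSpace ℝ (Fin 3))
        (s₁ s₂ : EuclideanSpace ℝ (Fin 3)) (σ σ' : ℤ → ℤ), IsHaggSeq σ ∧ IsHaggSeq σ' ∧
        (fun p => A₁ p + t₁) '' fccStacking 1 (Real.sqrt (2 / 3)) ⊆
          (fun p => L p + s₁) '' barlowStacking 1 (Real.sqrt (2 / 3)) σ ∧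
        (fun p => A₂ p + t₂) '' fccStacking 1 (Real.sqrt (2 / 3)) ⊆
          (fun p => L p + s₂) '' barlowStacking 1 (Real.sqrt (2 / 3)) σ')
    (htwin : A₁ '' fccStacking 1 (Real.sqrt (2 / 3)) ≠ A₂ '' fccStacking 1 (Real.sqrt (2 / 3)))
    (hdisj : ∀ p ∈ (fun q => A₁ q + t₁) '' fccStacking 1 (Real.sqrt (2 / 3)),
      p ∉ (fun q => A₂ q + t₂) '' fccStacking 1 (Real.sqrt (2 / 3))) :
    ∃ (L : EuclideanSpace ℝ (Fin 3) ≃ₗᵢ[ℝ] EuclideanSpace ℝ (Fin 3))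
        (s₁ s₂ : EuclideanSpace ℝ (Fin 3)) (σ σ' : ℤ → ℤ), IsHaggSeq σ ∧ IsHaggSeq σ' ∧
        (fun p => A₁ p + t₁) '' fccStacking 1 (Real.sqrt (2 / 3)) ⊆
          (fun p => L p + s₁) '' barlowStacking 1 (Real.sqrt (2 / 3)) σ ∧
        (fun p => A₂ p + t₂) '' fccStacking 1 (Real.sqrt (2 / 3)) ⊆
          (fun p => L p + s₂) '' barlowStacking 1 (Real.sqrt (2 / 3)) σ' ∧
    ∃ C : ℝ, ∀ h : ℝ, ∀ ρ : ℝ, 3 ≤ ρ →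
      ∀ X P₁ P₂ : Finset (EuclideanSpace ℝ (Fin 3)),
      (∀ p ∈ X, ∀ q ∈ X, p ≠ q → 1 ≤ dist p q) → P₁ ⊆ X → P₂ ⊆ X \ P₁ →
      (∀ p ∈ X, -(2 * 3) ≤ p 2 ∧ p 2 ≤ h + 2 * 3 ∧ p 0 ^ 2 + p 1 ^ 2 ≤ ρ ^ 2) →
      (∀ p, p ∈ P₁ ↔ (p ∈ (fun q => A₁ q + t₁) '' fccStacking 1 (Real.sqrt (2 / 3)) ∧
        -(2 * 3) ≤ p 2 ∧ p 2 ≤ -3 ∧ p 0 ^ 2 + p 1 ^ 2 ≤ ρ ^ 2)) →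
      (∀ p, p ∈ P₂ ↔ (p ∈ (fun q => A₂ q + t₂) '' fccStacking 1 (Real.sqrt (2 / 3)) ∧
        h + 3 ≤ p 2 ∧ p 2 ≤ h + 2 * 3 ∧ p 0 ^ 2 + p 1 ^ 2 ≤ ρ ^ 2)) →
      (∀ p ∈ X, p ∈ (fun q => A₁ q + t₁) '' fccStacking 1 (Real.sqrt (2 / 3)) ∨
        p ∈ (fun q => A₂ q + t₂) '' fccStacking 1 (Real.sqrt (2 / 3))) →
      ((((P₁ ×ˢ (X \ P₁)).filter fun pq => dist pq.1 pq.2 = 1).card : ℕ) : ℝ) +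
        ((((P₂ ×ˢ ((X \ P₁) \ P₂)).filter fun pq => dist pq.1 pq.2 = 1).card : ℕ) : ℝ) ≤
        contactDeficiency ((X \ P₁) \ P₂) +
          (Real.sqrt 2 / 4 * ∑ᶠ w ∈ {w ∈ fccStacking 1 (Real.sqrt (2 / 3)) | ‖w‖ = 1},
              |⟪w, A₁.symm (EuclideanSpace.single (2 : Fin 3) (1 : ℝ))⟫_ℝ| +
            Real.sqrt 2 / 4 * ∑ᶠ w ∈ {w ∈ fccStacking 1 (Real.sqrt (2 / 3)) | ‖w‖ = 1},
              |⟪w, A₂.symm (EuclideanSpace.single (2 : Fin 3) (1 : ℝ))⟫_ℝ| -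
            Real.sqrt 6 / 4 * Real.sqrt (1 - ⟪L (EuclideanSpace.single (2 : Fin 3) (1 : ℝ)),
              (EuclideanSpace.single (2 : Fin 3) (1 : ℝ))⟫_ℝ ^ 2)) * Real.pi * ρ ^ 2 +
          C * ρ + 15 / 2 * ((X.filter fun x => (ρ - 2) ^ 2 < x 0 ^ 2 + x 1 ^ 2).card : ℝ) := by
  classical
  obtain ⟨L, s₁, s₂, σ, σ', hσ, hσ', hsub₁, hsub₂⟩ := hcoax
  obtain ⟨C₁, hC₁⟩ := affineSampleDeficit_upper A₁ t₁ 3 (by norm_num)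
  obtain ⟨C₂, hC₂⟩ := affineSampleDeficit_upper A₂ t₂ 3 (by norm_num)
  refine ⟨L, s₁, s₂, σ, σ', hσ, hσ', hsub₁, hsub₂, C₁ + C₂ + 255 / 2 * Real.sqrt 2 * Real.pi, ?_⟩
  intro h ρ hρ X P₁ P₂ hX hP₁X hP₂X₁ hcyl hP₁ hP₂ hrigid
  set e₃ : EuclideanSpace ℝ (Fin 3) := EuclideanSpace.single (2 : Fin 3) (1 : ℝ) with he₃
  set φ₁ : ℝ := Real.sqrt 2 / 4 * ∑ᶠ w ∈ {w ∈ fccStacking 1 (Real.sqrt (2 / 3)) | ‖w‖ = 1},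
      |⟪w, A₁.symm e₃⟫_ℝ| with hφ₁
  set φ₂ : ℝ := Real.sqrt 2 / 4 * ∑ᶠ w ∈ {w ∈ fccStacking 1 (Real.sqrt (2 / 3)) | ‖w‖ = 1},
      |⟪w, A₂.symm e₃⟫_ℝ| with hφ₂
  have hP₂X : P₂ ⊆ X := hP₂X₁.trans sdiff_subset
  -- the pair is a twin pair in the frame: `σ 0 ≠ σ' 0`
  have htw : σ 0 ≠ σ' 0 := by
    intro heq
    obtain ⟨-, e₁⟩ := linear_image_eq_frame_of_subset A₁ L t₁ s₁ hσ hsub₁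
    obtain ⟨-, e₂⟩ := linear_image_eq_frame_of_subset A₂ L t₂ s₂ hσ' hsub₂
    exact htwin (by rw [e₁, e₂, heq])
  obtain ⟨M₁, M₂, e₁, e₂, ax₁, ax₂, habs₁, habs₂⟩ :=
    coaxial_twin_frames A₁ t₁ A₂ t₂ L s₁ s₂ hσ hσ' htw hsub₁ hsub₂ hdisj X hX hrigid
  -- (1) the two slab samples from above (original presentation)
  have hD₁ := hC₁ (-(2 * 3)) (-3) (by norm_num) ρ hρ P₁ hP₁
  have hD₂ := hC₂ (h + 3) (h + 2 * 3) (by ring) ρ hρ P₂ hP₂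
  -- (2) the rim-local cell ledger (normalised presentation)
  have hP₁' := hP₁
  have hP₂' := hP₂
  have hrigid' := hrigid
  have hdisj' := hdisj
  simp only [e₁, e₂] at hP₁' hP₂' hrigid' hdisj'
  have hcell := coaxial_rigid_cell_ledger_rimLocal M₁ s₁ M₂ s₂ X P₁ P₂ 3 h ρ le_rfl hρ hX hcyl hP₁X hP₂X
    hP₁' hP₂' hdisj' hrigid' habs₁ habs₂
  have hf₁ : Real.sqrt 2 / 4 * ∑ w ∈ fccSlots, |⟪M₁ w, e₃⟫_ℝ| = φ₁ := by
    rw [hφ₁, finsum_unit_fcc_symm_eq_sum_slots, sum_abs_inner_slots_eq_of_movedFcc_eq A₁ M₁ t₁ s₁ e₁]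
  have hf₂ : Real.sqrt 2 / 4 * ∑ w ∈ fccSlots, |⟪M₂ w, e₃⟫_ℝ| = φ₂ := by
    rw [hφ₂, finsum_unit_fcc_symm_eq_sum_slots, sum_abs_inner_slots_eq_of_movedFcc_eq A₂ M₂ t₂ s₂ e₂]
  rw [hf₁, hf₂, ax₁, ax₂] at hcell
  -- (3) the two splits of the skeleton
  have hs₁ := contactDeficiency_sdiff_split hP₁X
  have hs₂ := contactDeficiency_sdiff_split hP₂X₁
  -- (4) assemble
  have hC : (C₁ + C₂ + 255 / 2 * Real.sqrt 2 * Real.pi) * ρ =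
      C₁ * ρ + C₂ * ρ + 255 / 2 * Real.sqrt 2 * Real.pi * ρ := by ring
  rw [hC]
  linarith [hcell, hD₁, hD₂, hs₁, hs₂]

end Summit.Ventures.Crystal3D.Theorems

end
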